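/-
Copyright (c) 2026 the pub-hodgecm-mathlib formalisation cell (harness21).  Prover seat hodgecm-mathlib-LH4-p17 (g2) (Track A hand lent to L1 by the
chair's VALVE), Track B «K2-LIT» ∕ hLiu418 #184♮ = `stmt-HodgeConjecture-24832`, socket #41, row (T3-arch) of RULING «M-158j» ∕ LEAD F0P6-plan (g14)
BATCH #70 (1) ∕ #82 (3): «THE ARCHIMEDEAN COMPACTS OF STANDARD IWASAWA DATA ARE `P_Δ(L⁺ ⊗ ℝ)`-CONJUGATE» (majorant transitivity, Siegel form).
THEOREMS ONLY (no `def`, no instance, no notation, no named-fact hypothesis, no `sorry`).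
-/
import Summits.HodgeConjecture.HodgeConjecture.Theorems.K2LiuStdArchCompactConjugate          -- ★ B2 `exists_conj_archCompact`
import Summits.HodgeConjecture.HodgeConjecture.Theorems.K2LiuIwasawaHeightArchReduction        -- ★ `isSiegelDelta_archEmb_archPart`, `archEmb_archPart_mem`
import Summits.HodgeConjecture.HodgeConjecture.Theorems.K2LiuSiegelEisensteinRightTranslation  -- ★ (T) §2 `exists_iwasawaDatum_conj`
import HarnessLib

/-!
# Crux `HLiu418`, socket #41, road (R-c) row (T3-arch): THE ARCHIMEDEAN COMPACTS OF ANY TWO STANDARD IWASAWA DATA ARE CONJUGATE BY AN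
# ARCHIMEDEAN ELEMENT OF THE SIEGEL PARABOLIC `P_Δ(L⁺ ⊗ ℝ)`

Cell `hodgecm-mathlib`, crux item hLiu418 = `stmt-HodgeConjecture-24832`; squad K2 ∕ K2Liu (L1, LEAD F0P6-plan (g14)); desk K2Liu-p25 (g2); prover
LH4-p17 (g2) (valve hand).  THEOREMS ONLY; lane `--supports stmt-HodgeConjecture-24832 --as helper` (count-neutral; closes no socket by itself).

WHY (RULING «M-158j», LEAD BATCH #66 (1) ∕ #70 (1)).  Socket #41 quantifies over EVERY standard Iwasawa datum `𝒦′` (★ `IwasawaDatum.IsStd`), while the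
middle-term organ (★ I-lineage, `hΛK : Λ(K_{GL₂}) ⊆ 𝒦.K`) runs at LEVI-ADAPTED data only.  Road (R-c) transports #41 along the NORMALISED translate by
`p ∈ P_Δ(𝔸)` (★ (T) `K2LiuSiegelEisensteinRightTranslation`: `continuation_transport`, `isStandardSectionFamily_normalisedTranslate` with the letters
`hp : IsSiegelDelta p`, `hKK′ : ∀ k ∈ 𝒦.K, p⁻¹ k p ∈ 𝒦′.K`).  At the archimedean place this needs: **the archimedean compact `C′_∞` of the arbitrary
standard `𝒦′` is a `P_Δ(L⁺ ⊗ ℝ)`-conjugate of the archimedean compact of the adapted reference datum** — the row (T3-arch), not in the tree before this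
file (★ B2 `K2LiuStdArchCompactConjugate.exists_conj_archCompact` conjugates INSIDE `H(L⁺ ⊗ ℝ)`, to the sign-block-diagonal compact; ★
`K2LiuIwasawaDatumAdapted(_Std)` is place-set adaptation).
THE MATHEMATICS ([Weil1964, Chap. I n° 8]; [BorelJacquet1979, §4.1]; [PlatonovRapinchuk1994, §3.2]; [MoeglinWaldspurger1995, I.2.1]).  Two standard
archimedean compacts `C₁, C₂ ≤ H_∞` are both `H_∞`-conjugate to the stabiliser of the diagonal majorant (★ B2 at every complex place), hence
`C₂ = h C₁ h⁻¹` with `h = g₂ g₁⁻¹ ∈ H_∞`; by the IWASAWA DECOMPOSITION IN `H_∞` for the standard datum `𝒦₁` (§1: the adelic decomposition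
`𝒦₁.iwasawa` projected to the archimedean component — ★ `archPart`, ★ `isSiegelDelta_archEmb_archPart`, ★ `archEmb_archPart_mem`) `h = p·k` with
`p ∈ P_Δ(L⁺ ⊗ ℝ)` and `k ∈ C₁`, and `k` normalises `C₁` (§2), so `C₂ = p C₁ p⁻¹`.
* §1 `exists_arch_iwasawa_of_isStd` — `H_∞ = P_Δ(L⁺ ⊗ ℝ) · C_∞` for a standard datum (archimedean projection of `𝒦.iwasawa`).
* §2 `archToAdelic_conj_mem_iff` — `(k⁻¹ a k, 1) ∈ 𝒦.K ↔ (a, 1) ∈ 𝒦.K` for `(k, 1) ∈ 𝒦.K`.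
* §3 HEAD **`exists_isSiegelDelta_conj_archCompact`** — for `𝒦₁.IsStd`, `𝒦₂.IsStd`: `∃ p ∈ H_∞`, `(p, 1) ∈ P_Δ(𝔸)`, with
  `(p⁻¹ a p, 1) ∈ 𝒦₁.K ↔ (a, 1) ∈ 𝒦₂.K` for every archimedean `a` («`C₂ = p C₁ p⁻¹`»).
* §4 **`exists_isSiegelDelta_conjDatum_arch_iff`** — (T)'s currency: `∃ (p ∈ H(𝔸)) (𝒦)`, `p ∈ P_Δ(𝔸)` purely archimedean (`(p_∞, 1) = p`),
  `k ∈ 𝒦.K ↔ p⁻¹ k p ∈ 𝒦₂.K` (★ (T) §2 `exists_iwasawaDatum_conj 𝒦₂ p`), and the archimedean compact of `𝒦` IS that of the reference `𝒦₁`: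
  `(a, 1) ∈ 𝒦.K ↔ (a, 1) ∈ 𝒦₁.K`.  Its «→» half of the third conjunct is (T) §3's `hKK′` with `𝒦′ := 𝒦₂`; which reference `𝒦₁` is Levi-compatible
  for ★ α3-2's chart `Λ` is the consumer's choice (the I-lineage ∕ road (R-a) at the finite places — open finite parts are NOT conjugate to
  Levi-adapted ones, (T3-fin) «≠», BATCH #70 (1)), and `IsStd` of the conjugate datum is the companion §5 row (K2Liu-p25 ∕ p27 recipe), not this file.
HONEST LABEL.  Count-neutral helper: `HC_CM` is proved only modulo the 7 printed citations (2 remaining named inputs: hLiu418 =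
`stmt-HodgeConjecture-24832`, h413 = `stmt-HodgeConjecture-24833`) until rung 0 closes; this file closes no socket.

## References
* [Weil1964] A. Weil, *Sur certains groupes d'opérateurs unitaires*, Acta Math. 111 (1964), Chap. I n° 8 (majorants, the compact stabiliser).
* [BorelJacquet1979] A. Borel, H. Jacquet, *Automorphic forms and automorphic representations*, Proc. Symp. Pure Math. 33.1 (1979), §4.1
  (`G(𝔸) = G_∞ × G(𝔸_f)`; Iwasawa `G = P·K`).
* [PlatonovRapinchuk1994] V. Platonov, A. Rapinchuk, *Algebraic Groups and Number Theory* (1994), §3.2 (maximal compact subgroups of real groups are conjugate).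
* [MoeglinWaldspurger1995] C. Mœglin, J.-L. Waldspurger, *Spectral decomposition and Eisenstein series* (1995), I.2.1 (good maximal compacts, `G = P K`).
* [Tan1999] V. Tan, *Poles of Siegel Eisenstein series on U(n,n)*, Canad. J. Math. 51 (1999), §1 p. 166 (`K = K_∞ ∏ K_v`, standard sections).
-/

set_option autoImplicit false
set_option linter.dupNamespace false -- the mandated namespace repeats `HodgeConjecture.HodgeConjecture`

open NumberField NumberField.mixedEmbedding
open Literature.NumberTheory.Automorphic Literature.NumberTheory.Automorphic.UnitaryGroup
open Literature.NumberTheory.GelbartRogawski1991 Literature.NumberTheory.GelbartRogawski1991.GRConstruction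
open Literature.NumberTheory.K2Lit.SiegelDoubled

namespace Summit.HodgeConjecture.HodgeConjecture.Cruxes.HLiu418.K2LiuArchMajorantTransitivity

open Summit.HodgeConjecture.HodgeConjecture.Cruxes.HLiu418.K2LiuStdArchCompactConjugate (exists_conj_archCompact)
open Summit.HodgeConjecture.HodgeConjecture.Cruxes.HLiu418.K2LiuArchOneParameterOrbitDefs (archEmb_eq_archToAdelic)
open Summit.HodgeConjecture.HodgeConjecture.Cruxes.HLiu418.K2LiuIwasawaHeightArchReduction (isSiegelDelta_archEmb_archPart archEmb_archPart_mem)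
open Summit.HodgeConjecture.HodgeConjecture.Cruxes.HLiu418.K2LiuSiegelEisensteinRightTranslation (exists_iwasawaDatum_conj)

variable (L : Type) [Field L] [NumberField L] [IsCMField L]
variable {N M n : ℕ} (e : Fin N × Fin M ≃ Fin n)
  (dV : Fin N → L) (hdV : ∀ i, IsCMField.complexConj L (dV i) = dV i) (hdV0 : ∀ i, dV i ≠ 0)
  (dW : Fin M → L) (hdW : ∀ i, IsCMField.complexConj L (dW i) = dW i) (hdW0 : ∀ i, dW i ≠ 0)

/-! ## §1 The Iwasawa decomposition IN `H(L⁺ ⊗ ℝ)` for a standard datum -/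

/-- **ARCHIMEDEAN IWASAWA FOR A STANDARD DATUM: `H_∞ = P_Δ(L⁺ ⊗ ℝ) · C_∞`.**  For `𝒦.IsStd` and `h ∈ H(L⁺ ⊗ ℝ)` there are `p, k ∈ H(L⁺ ⊗ ℝ)` with
`(p, 1) ∈ P_Δ(𝔸)`, `(k, 1) ∈ 𝒦.K` and `h = p·k`: the adelic decomposition `(h, 1) = P·K` (★ `IwasawaDatum.iwasawa`) projected to the archimedean
component (★ `archPart`, a homomorphism), `P_∞` Siegel (★ `isSiegelDelta_archEmb_archPart` — the Siegel relation is entrywise linear) and `(K_∞, 1) ∈ 𝒦.K`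
for a STANDARD datum (★ `archEmb_archPart_mem`, (P0)). [cite: BorelJacquet1979, §4.1] [cite: MoeglinWaldspurger1995, I.2.1] [cite: Tan1999, §1 p. 166] -/
theorem exists_arch_iwasawa_of_isStd {𝒦 : IwasawaDatum L e dV hdV dW hdW} (h𝒦 : 𝒦.IsStd)
    (h : arch (Fp L) L (IsCMField.complexConj L) (n + n) (hermD L e dV hdV dW hdW)) :
    ∃ p k : arch (Fp L) L (IsCMField.complexConj L) (n + n) (hermD L e dV hdV dW hdW),
      IsSiegelDelta L e dV hdV dW hdW (archToAdelic (Fp L) L (IsCMField.complexConj L) (n + n) (hermD L e dV hdV dW hdW) p) ∧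
      (archToAdelic (Fp L) L (IsCMField.complexConj L) (n + n) (hermD L e dV hdV dW hdW) k : HA L e dV hdV dW hdW) ∈ 𝒦.K ∧
      h = p * k := by
  obtain ⟨P, K, hP, hK, hPK⟩ := 𝒦.iwasawa (archToAdelic (Fp L) L (IsCMField.complexConj L) (n + n) (hermD L e dV hdV dW hdW) h)
  refine ⟨archPart (Fp L) L (IsCMField.complexConj L) (n + n) (hermD L e dV hdV dW hdW) P,
    archPart (Fp L) L (IsCMField.complexConj L) (n + n) (hermD L e dV hdV dW hdW) K, ?_, ?_, ?_⟩
  · have h1 := isSiegelDelta_archEmb_archPart L e dV hdV dW hdW hP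
    rwa [archEmb_eq_archToAdelic] at h1
  · have h2 := archEmb_archPart_mem h𝒦 hK
    rwa [archEmb_eq_archToAdelic] at h2
  · have h3 := congrArg (archPart (Fp L) L (IsCMField.complexConj L) (n + n) (hermD L e dV hdV dW hdW)) hPK
    rw [archPart_archToAdelic] at h3
    exact h3.trans (map_mul _ _ _)

/-! ## §2 `C_∞` is normalised by its own elements -/

/-- for `(k, 1) ∈ 𝒦.K` and any archimedean `a`: `(k⁻¹ a k, 1) ∈ 𝒦.K ↔ (a, 1) ∈ 𝒦.K` (`𝒦.K` is a subgroup and `a ↦ (a, 1)` a homomorphism).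
[cite: BorelJacquet1979, §4.1] -/
theorem archToAdelic_conj_mem_iff (𝒦 : IwasawaDatum L e dV hdV dW hdW)
    {k : arch (Fp L) L (IsCMField.complexConj L) (n + n) (hermD L e dV hdV dW hdW)}
    (hk : (archToAdelic (Fp L) L (IsCMField.complexConj L) (n + n) (hermD L e dV hdV dW hdW) k : HA L e dV hdV dW hdW) ∈ 𝒦.K)
    (a : arch (Fp L) L (IsCMField.complexConj L) (n + n) (hermD L e dV hdV dW hdW)) :
    (archToAdelic (Fp L) L (IsCMField.complexConj L) (n + n) (hermD L e dV hdV dW hdW) (k⁻¹ * a * k) : HA L e dV hdV dW hdW) ∈ 𝒦.K ↔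
      (archToAdelic (Fp L) L (IsCMField.complexConj L) (n + n) (hermD L e dV hdV dW hdW) a : HA L e dV hdV dW hdW) ∈ 𝒦.K := by
  rw [map_mul, map_mul, map_inv]
  constructor
  · intro h
    have e1 : (archToAdelic (Fp L) L (IsCMField.complexConj L) (n + n) (hermD L e dV hdV dW hdW) a : HA L e dV hdV dW hdW) =
        archToAdelic (Fp L) L (IsCMField.complexConj L) (n + n) (hermD L e dV hdV dW hdW) k *
          ((archToAdelic (Fp L) L (IsCMField.complexConj L) (n + n) (hermD L e dV hdV dW hdW) k)⁻¹ *
              archToAdelic (Fp L) L (IsCMField.complexConj L) (n + n) (hermD L e dV hdV dW hdW) a *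
            archToAdelic (Fp L) L (IsCMField.complexConj L) (n + n) (hermD L e dV hdV dW hdW) k) *
          (archToAdelic (Fp L) L (IsCMField.complexConj L) (n + n) (hermD L e dV hdV dW hdW) k)⁻¹ := by
      group
    rw [e1]
    exact 𝒦.K.mul_mem (𝒦.K.mul_mem hk h) (𝒦.K.inv_mem hk)
  · intro h
    exact 𝒦.K.mul_mem (𝒦.K.mul_mem (𝒦.K.inv_mem hk) h) hk

/-! ## §3 HEAD — the archimedean compacts of two standard data are `P_Δ(L⁺ ⊗ ℝ)`-conjugate -/

include hdV0 hdW0 in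
/-- **(T3-arch) MAJORANT TRANSITIVITY, SIEGEL FORM.**  For two STANDARD Iwasawa data `𝒦₁, 𝒦₂` of the doubled group there is an archimedean element
`p ∈ H(L⁺ ⊗ ℝ)` of the SIEGEL PARABOLIC (`(p, 1) ∈ P_Δ(𝔸)`) conjugating the archimedean compact of `𝒦₂` onto that of `𝒦₁`:
`(p⁻¹ a p, 1) ∈ 𝒦₁.K ↔ (a, 1) ∈ 𝒦₂.K` for every `a ∈ H(L⁺ ⊗ ℝ)` — i.e. `C₂ = p C₁ p⁻¹`.  PROOF: both compacts are `H_∞`-conjugate to the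
sign-block-diagonal compact (★ B2 `exists_conj_archCompact`, elements `g₁, g₂`); write `g₂ g₁⁻¹ = p·k` by §1 for `𝒦₁`; then
`g₂⁻¹ a g₂ = g₁⁻¹ (k⁻¹ (p⁻¹ a p) k) g₁` and §2 removes `k`. [cite: Weil1964, Chap. I n° 8] [cite: PlatonovRapinchuk1994, §3.2] [cite: BorelJacquet1979, §4.1]
[cite: MoeglinWaldspurger1995, I.2.1] -/
theorem exists_isSiegelDelta_conj_archCompact {𝒦₁ 𝒦₂ : IwasawaDatum L e dV hdV dW hdW} (h₁ : 𝒦₁.IsStd) (h₂ : 𝒦₂.IsStd) :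
    ∃ p : arch (Fp L) L (IsCMField.complexConj L) (n + n) (hermD L e dV hdV dW hdW),
      IsSiegelDelta L e dV hdV dW hdW (archToAdelic (Fp L) L (IsCMField.complexConj L) (n + n) (hermD L e dV hdV dW hdW) p) ∧
      ∀ a : arch (Fp L) L (IsCMField.complexConj L) (n + n) (hermD L e dV hdV dW hdW),
        (archToAdelic (Fp L) L (IsCMField.complexConj L) (n + n) (hermD L e dV hdV dW hdW) (p⁻¹ * a * p) : HA L e dV hdV dW hdW) ∈ 𝒦₁.K ↔
          (archToAdelic (Fp L) L (IsCMField.complexConj L) (n + n) (hermD L e dV hdV dW hdW) a : HA L e dV hdV dW hdW) ∈ 𝒦₂.K := by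
  obtain ⟨g₁, hg₁⟩ := exists_conj_archCompact L e dV hdV hdV0 dW hdW hdW0 h₁
  obtain ⟨g₂, hg₂⟩ := exists_conj_archCompact L e dV hdV hdV0 dW hdW hdW0 h₂
  -- Iwasawa in `H_∞` for `𝒦₁`: `g₂ g₁⁻¹ = p k`
  obtain ⟨p, k, hp, hk, hpk⟩ := exists_arch_iwasawa_of_isStd L e dV hdV dW hdW h₁ (g₂ * g₁⁻¹)
  refine ⟨p, hp, fun a => ?_⟩
  have hg : g₂ = p * k * g₁ := by rw [← hpk, inv_mul_cancel_right]
  have hconj : g₂⁻¹ * a * g₂ = g₁⁻¹ * (k⁻¹ * (p⁻¹ * a * p) * k) * g₁ := by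
    rw [hg]
    group
  have key := hg₁ (k⁻¹ * (p⁻¹ * a * p) * k)
  rw [← hconj] at key
  exact ((archToAdelic_conj_mem_iff L e dV hdV dW hdW 𝒦₁ hk (p⁻¹ * a * p)).symm.trans key).trans (hg₂ a).symm

/-! ## §4 The same in (T)'s currency: a `P_Δ`-conjugate datum with prescribed archimedean compact -/

include hdV0 hdW0 in
/-- **THE `P_Δ`-CONJUGATE OF A STANDARD DATUM WITH THE ARCHIMEDEAN COMPACT OF A REFERENCE STANDARD DATUM.**  For standard `𝒦₁` (reference) and `𝒦₂`
(arbitrary) there are `p ∈ P_Δ(𝔸)`, PURELY ARCHIMEDEAN (`(p_∞, 1) = p`), and an Iwasawa datum `𝒦` with `k ∈ 𝒦.K ↔ p⁻¹ k p ∈ 𝒦₂.K` (the conjugate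
datum `p 𝒦₂ p⁻¹` of ★ (T) §2 `exists_iwasawaDatum_conj 𝒦₂ p`) whose archimedean compact is that of `𝒦₁`: `(a, 1) ∈ 𝒦.K ↔ (a, 1) ∈ 𝒦₁.K`.  The «→»
half of the conjugation law is ★ (T) §3 `isStandardSectionFamily_normalisedTranslate`'s letter `hKK′` (`𝒦′ := 𝒦₂`), `IsSiegelDelta p` its `hp`.
[cite: BorelJacquet1979, §4.1] [cite: MoeglinWaldspurger1995, I.2.1] [cite: Weil1964, Chap. I n° 8] [cite: Tan1999, §1 p. 166] -/
theorem exists_isSiegelDelta_conjDatum_arch_iff {𝒦₁ 𝒦₂ : IwasawaDatum L e dV hdV dW hdW} (h₁ : 𝒦₁.IsStd) (h₂ : 𝒦₂.IsStd) :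
    ∃ (p : HA L e dV hdV dW hdW) (𝒦 : IwasawaDatum L e dV hdV dW hdW),
      IsSiegelDelta L e dV hdV dW hdW p ∧
      (archToAdelic (Fp L) L (IsCMField.complexConj L) (n + n) (hermD L e dV hdV dW hdW)
          (archPart (Fp L) L (IsCMField.complexConj L) (n + n) (hermD L e dV hdV dW hdW) p) : HA L e dV hdV dW hdW) = p ∧
      (∀ k : HA L e dV hdV dW hdW, k ∈ 𝒦.K ↔ p⁻¹ * k * p ∈ 𝒦₂.K) ∧
      ∀ a : arch (Fp L) L (IsCMField.complexConj L) (n + n) (hermD L e dV hdV dW hdW),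
        (archToAdelic (Fp L) L (IsCMField.complexConj L) (n + n) (hermD L e dV hdV dW hdW) a : HA L e dV hdV dW hdW) ∈ 𝒦.K ↔
          (archToAdelic (Fp L) L (IsCMField.complexConj L) (n + n) (hermD L e dV hdV dW hdW) a : HA L e dV hdV dW hdW) ∈ 𝒦₁.K := by
  obtain ⟨q, hq, hiff⟩ := exists_isSiegelDelta_conj_archCompact L e dV hdV hdV0 dW hdW hdW0 h₂ h₁
  obtain ⟨𝒦, h𝒦⟩ := exists_iwasawaDatum_conj L e dV hdV dW hdW 𝒦₂
    (archToAdelic (Fp L) L (IsCMField.complexConj L) (n + n) (hermD L e dV hdV dW hdW) q : HA L e dV hdV dW hdW)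
  refine ⟨(archToAdelic (Fp L) L (IsCMField.complexConj L) (n + n) (hermD L e dV hdV dW hdW) q : HA L e dV hdV dW hdW), 𝒦, hq,
    by rw [archPart_archToAdelic], h𝒦, fun a => ?_⟩
  have hiff' := hiff a
  rw [map_mul, map_mul, map_inv] at hiff'
  exact (h𝒦 _).trans hiff'

end Summit.HodgeConjecture.HodgeConjecture.Cruxes.HLiu418.K2LiuArchMajorantTransitivity
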